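import Mathlib
import HarnessLib.Audit
import Summits.PneNP.PneNP.Theorems.PstarGateCaseP
import Summits.PneNP.PneNP.Theorems.PstarGateUnitBridge
import Summits.PneNP.PneNP.Theorems.PstarNorUnitRegime

/-!
# One GATED chord, CASE P with a PIN: the core is the PIN + GATE triangle (ROUND-25, O2 / E2 branch B0/pin CLOSED; prover-1 g18)

FRONTIER range-avoidance ladder, rung F-N3 (`stmt-PneNP-19007`), cell `pnp-ideate` (this seat's `HOME/pnp-ideate-prover-1/g18/E2-PLAN.md` §2 B0/B2;
memo `r24/CORE-BOUND-NOTES.md` §10.1 "PIN + GATE"); restricted-model proof complexity — nothing here bears on `P` versus `NP`.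

The first COMPLETE branch of the E2 count.  CASE P of the one-gate configuration (the whole model single-read; `w₂` state-free on the chords) in which
the basis-changed second constraint is a PIN: `q = q_{(1,0)} = x_σ + κ` (`σ ≠ u`).  Then:

* `gate_unit_of_sheet` — `PstarGateUnitBridge.gate_unit_of_dir` with the gate's read sheet `{x_τ = c}` for either `c` (the original has `c = 0`);
* `no_other_chord_of_pin` — **there is no other chord**: every `e' ≠ e` is ON on all of `Z(q)` (`PstarGateBridge.caseP_forced`), a hyperplane, and a
  rank-four AND-sum is constant on no hyperplane (`PstarForcing.not_forced_of_affine`) unless `Z(q) = ∅`;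
* `pair_of_pin` — **`D e` is a CONS-T pair** `{j₁, j₂}` with `σ ∈ j₁`, `u ∈ j₂` (`gate_unit_of_sheet` with the gate `g₀` itself as payer and the
  sheet `{x_u = κ₀ + 1}` on which the gate reads);
* `card_eq_three_of_pin` — hence, with `J₀` XOR-closed and `J₀ ∖ N` peelable, **`J₀ = D e + e` is a triangle: `#J₀ = 3`**
  (`PstarNorUnitRegime.J₀_eq_of_single`).
So the PIN + GATE unit of the kit census (k = 1 gate, `#J₀ = 3`) is the ONLY E2 configuration whose second constraint pins a literal — for every core size.
-/

set_option linter.dupNamespace false -- `Summit.PneNP.PneNP.…`: summit = sub-problem name (D-0017 single-conjunct layout)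

open Finset Module Literature.Computability.Complexity
open Summit.PneNP.PneNP.Theorems.PstarTyped (Typed)
open Summit.PneNP.PneNP.Theorems.PstarSALevel (varSet bdry BoundaryExpanding SimpleOverlap)
open Summit.PneNP.PneNP.Theorems.PstarGapLinearised (andPair andPair_subset_varSet)
open Summit.PneNP.PneNP.Theorems.PstarGapPeeling (not_mem_varSet_of_private)
open Summit.PneNP.PneNP.Theorems.PstarXCore (xverts)
open Summit.PneNP.PneNP.Theorems.PstarCoreBound (XorClosed)
open Summit.PneNP.PneNP.Theorems.PstarCubeIdeals (IsAffineFn IsQuadFn isAffineFn_of_linear exists_affine_of_codimTwo)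
open Summit.PneNP.PneNP.Theorems.PstarRankRigidityTwo (linPart linPart_apply)
open Summit.PneNP.PneNP.Theorems.PstarProductRank (qform polar)
open Summit.PneNP.PneNP.Theorems.PstarForcing (not_forced_of_affine)
open Summit.PneNP.PneNP.Theorems.PstarReadSumset (V2)
open Summit.PneNP.PneNP.Theorems.PstarChordSystem (ChordSystem)
open Summit.PneNP.PneNP.Theorems.PstarChordBridgeTools
open Summit.PneNP.PneNP.Theorems.PstarChordBridge
open Summit.PneNP.PneNP.Theorems.PstarChordBridgeCotree (Peelable)
open Summit.PneNP.PneNP.Theorems.PstarChordBridgeForcing (gam qform_add' rank_four_of_wf sys_u_eq)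
open Summit.PneNP.PneNP.Theorems.PstarChordBridgeBasis (qDir)
open Summit.PneNP.PneNP.Theorems.PstarChordBridgePointwise (forced_of_read_dir)
open Summit.PneNP.PneNP.Theorems.PstarNorUnitBridge (xor_not_mem_bdry_of_even)
open Summit.PneNP.PneNP.Theorems.PstarGateUnit (unit_of_payer)
open Summit.PneNP.PneNP.Theorems.PstarGateUnitBridge (isAffineFn_coord linPart_coord)
open Summit.PneNP.PneNP.Theorems.PstarNorUnitRegime (J₀_eq_of_single)
open Summit.PneNP.PneNP.Theorems.PstarGateBridge (GateHyp gate_reads gate_reads_line caseP_forced)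

namespace Summit.PneNP.PneNP.Theorems.PstarGateCasePPin

variable {n m : ℕ}

/-- **The gate unit on the read sheet `{x_τ = c}`** — `PstarGateUnitBridge.gate_unit_of_dir`, either sheet. -/
theorem gate_unit_of_sheet (I : LocalMap 4 n m) (hI : I.IsPure xorAndPred) (hT : Typed I) (hS : SimpleOverlap I) {r : ℕ}
    (hB : BoundaryExpanding r I) {B : BridgeData n m} (hW : B.WF I) (hr : (B.J₀ ∪ B.G₁ ∪ B.G₂).card ≤ r)
    (hG₁ : Disjoint B.G₁ B.J₀) (hG₂ : Disjoint B.G₂ B.J₀) (hinf : (sys I B).Infeasible B.N) {mv : V2} (hm : mv ≠ 0)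
    (hU1 : ∀ e a, ((sys I B).ρ e a = 0 ∨ (sys I B).ρ e a = mv) ∧ ((sys I B).ρ' e a = 0 ∨ (sys I B).ρ' e a = mv))
    {e : Fin m} (he : e ∈ B.N) {σ τ : Fin n} (hστ : σ ≠ τ) {κ : ZMod 2} (hq : ∀ x, qDir I B mv x = x σ + κ) (c : ZMod 2)
    (hread : ∀ x : Fin n → ZMod 2, x τ + c = 0 → (sys I B).ρ e x ≠ 0 ∨ (sys I B).ρ' e x ≠ 0)
    {g : Fin m} (hg : g ∈ B.G₁ ∪ B.G₂) (hgv : ∀ v ∈ andPair I g, v = σ ∨ v = τ ∨ v ∈ andPair I e) :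
    ∃ j₁ j₂ : Fin m, j₁ ≠ j₂ ∧ B.D e = {j₁, j₂} ∧ Disjoint (andPair I j₁) (andPair I j₂) ∧ σ ∈ andPair I j₁ ∧ τ ∈ andPair I j₂ := by
  classical
  have heD : e ∉ B.D e := fun h => (mem_sdiff.1 (hW.hD e he h)).2 he
  have hJr : B.J₀.card ≤ r := (card_le_card (subset_union_left.trans subset_union_left)).trans hr
  have hZ : ∀ x : Fin n → ZMod 2, x σ + κ = 0 → x τ + c = 0 →
      qform (B.D e) (fun j => I.vars j 2) (fun j => I.vars j 3) x + (gam B e + 1) = 0 := by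
    intro x hσ hτ
    have h := forced_of_read_dir I B hinf hm hU1 he (by rw [hq, hσ]) (hread x hτ)
    rw [h]; generalize gam B e = t; revert t; decide
  have hquad : IsQuadFn (fun x => qform (B.D e) (fun j => I.vars j 2) (fun j => I.vars j 3) x + (gam B e + 1)) := by
    refine ⟨polar (B.D e) (fun j => I.vars j 2) (fun j => I.vars j 3), fun x w => ?_⟩
    dsimp only
    rw [qform_add' I (B.D e)]
    generalize qform (B.D e) (fun j => I.vars j 2) (fun j => I.vars j 3) x = a
    generalize qform (B.D e) (fun j => I.vars j 2) (fun j => I.vars j 3) w = b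
    generalize qform (B.D e) (fun j => I.vars j 2) (fun j => I.vars j 3) (0 : Fin n → ZMod 2) = c'
    generalize polar (B.D e) (fun j => I.vars j 2) (fun j => I.vars j 3) x w = d
    generalize gam B e = t
    revert a b c' d t; decide
  have single_ne : ∀ {a b : Fin n}, a ≠ b → (Pi.single a (1 : ZMod 2) : Fin n → ZMod 2) b = 0 := fun h => Pi.single_eq_of_ne (Ne.symm h) _
  have h₁₁ : ∀ x : Fin n → ZMod 2, (x + (Pi.single σ (1 : ZMod 2) : Fin n → ZMod 2)) σ + κ = x σ + κ + 1 := fun x => by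
    rw [Pi.add_apply, Pi.single_eq_same]; ring
  have h₂₁ : ∀ x : Fin n → ZMod 2, (x + (Pi.single σ (1 : ZMod 2) : Fin n → ZMod 2)) τ + c = x τ + c := fun x => by
    rw [Pi.add_apply, single_ne hστ, add_zero]
  have h₁₂ : ∀ x : Fin n → ZMod 2, (x + (Pi.single τ (1 : ZMod 2) : Fin n → ZMod 2)) σ + κ = x σ + κ := fun x => by
    rw [Pi.add_apply, single_ne (Ne.symm hστ), add_zero]
  have h₂₂ : ∀ x : Fin n → ZMod 2, (x + (Pi.single τ (1 : ZMod 2) : Fin n → ZMod 2)) τ + c = x τ + c + 1 := fun x => by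
    rw [Pi.add_apply, Pi.single_eq_same]; ring
  obtain ⟨m₁, m₂, hm₁, hm₂, hQ⟩ := exists_affine_of_codimTwo (f := fun x => qform (B.D e) (fun j => I.vars j 2) (fun j => I.vars j 3) x + (gam B e + 1))
    (l₁ := fun x : Fin n → ZMod 2 => x σ + κ) (l₂ := fun x : Fin n → ZMod 2 => x τ + c) h₁₁ h₂₁ h₁₂ h₂₂ hquad hZ (isAffineFn_coord τ c)
  have hgJ : g ∉ B.J₀ := fun h => by
    rcases mem_union.1 hg with hg' | hg'
    · exact disjoint_left.1 hG₁ hg' h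
    · exact disjoint_left.1 hG₂ hg' h
  have hDJ : insert e (B.D e) ⊆ B.J₀ := insert_subset (hW.hN he) ((hW.hD e he).trans sdiff_subset)
  have hgX : g ∉ insert e (B.D e) := fun h => hgJ (hDJ h)
  have hrX : (insert g (insert e (B.D e))).card ≤ r := by
    refine le_trans (card_le_card ?_) hr
    refine insert_subset ?_ (hDJ.trans (subset_union_left.trans subset_union_left))
    rcases mem_union.1 hg with hg' | hg'
    · exact mem_union_left _ (mem_union_right _ hg')
    · exact mem_union_right _ hg'
  have hpriv : ∀ j ∈ B.D e, ∀ v ∈ andPair I e, v ∉ varSet I j := by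
    intro j hj v hv
    have hjJ : j ∈ B.J₀ := (mem_sdiff.1 (hW.hD e he hj)).1
    have hne : j ≠ e := fun h => heD (h ▸ hj)
    obtain ⟨hc2, hc3⟩ := hW.hchord e he
    rcases (PstarChordEndgameTools.mem_andPair_iff I e v).1 hv with rfl | rfl
    · exact not_mem_varSet_of_private I (hW.hN he) hjJ hne hc2 (PstarCentreFree.vars_mem_varSet I e 2)
    · exact not_mem_varSet_of_private I (hW.hN he) hjJ hne hc3 (PstarCentreFree.vars_mem_varSet I e 3)
  exact unit_of_payer I hI hT hS hB heD (xor_not_mem_bdry_of_even I hI (hW.hDeven e he)) hpriv (isAffineFn_coord σ κ)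
    (isAffineFn_coord τ c) hm₁ hm₂ (c := gam B e + 1) hQ hστ (linPart_coord σ κ) (linPart_coord τ c)
    (rank_four_of_wf I hI hS hB hW hJr he) hgX hgv hrX

/-- **CASE P with a pin has no other chord.**  Other chords read along `(1,0)`; `q = x_σ + κ`; `e' ≠ e` a chord ⟹ contradiction: `e'` is ON on the
hyperplane `Z(q)` (`caseP_forced`), which `not_forced_of_affine` forbids for the rank-four `Q_{D e'}`. -/
theorem no_other_chord_of_pin (I : LocalMap 4 n m) (hI : I.IsPure xorAndPred) (hT : Typed I) (hS : SimpleOverlap I) {r : ℕ}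
    (hB : BoundaryExpanding r I) {B : BridgeData n m} (hW : B.WF I) (hJr : B.J₀.card ≤ r) (hL : Lift I B) {e : Fin m} (hG : GateHyp I B e)
    (hT3 : ¬ ∃ z, Solution I B B.J₀ z)
    (hP : ∀ e' ∈ B.N, e' ≠ e → ∀ a, ((sys I B).ρ e' a = 0 ∨ (sys I B).ρ e' a = (1, 0)) ∧ ((sys I B).ρ' e' a = 0 ∨ (sys I B).ρ' e' a = (1, 0)))
    (hread : ∀ e' ∈ B.N, e' ≠ e → ∀ a, (sys I B).ρ e' a ≠ 0 ∨ (sys I B).ρ' e' a ≠ 0)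
    {σ : Fin n} {κ : ZMod 2} (hq : ∀ x, qDir I B (1, 0) x = x σ + κ) : ∀ e' ∈ B.N, e' = e := by
  intro e' he'
  by_contra hne
  have hforced : ∀ x : Fin n → ZMod 2, x σ + κ = 0 → qform (B.D e') (fun j => I.vars j 2) (fun j => I.vars j 3) x = gam B e' + 1 :=
    fun x hx => (caseP_forced I hI hT hW hL hG hT3 hP hread (x := x) (by rw [hq, hx])).1 e' he' hne
  have hall := not_forced_of_affine (q := fun x : Fin n → ZMod 2 => x σ + κ) (isAffineFn_coord σ κ) (qform_add' I (B.D e'))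
    (rank_four_of_wf I hI hS hB hW hJr he') hforced
  -- the hyperplane `{x_σ = κ}` is not empty
  have h := hall (Pi.single σ κ)
  simp only [Pi.single_eq_same] at h
  have e2 : ∀ k : ZMod 2, k + k ≠ 1 := by decide
  exact e2 κ h

/-- **CASE P with a pin: `D e` is a CONS-T pair** `{j₁, j₂}` with `σ ∈ j₁` and the gate partner `u ∈ j₂`. -/
theorem pair_of_pin (I : LocalMap 4 n m) (hI : I.IsPure xorAndPred) (hT : Typed I) (hS : SimpleOverlap I) {r : ℕ}
    (hB : BoundaryExpanding r I) {B : BridgeData n m} (hW : B.WF I) (hr : (B.J₀ ∪ B.G₁ ∪ B.G₂).card ≤ r)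
    (hd₁ : Disjoint B.G₁ B.J₀) (hd₂ : Disjoint B.G₂ B.J₀) (hL : Lift I B) {e : Fin m} (hG : GateHyp I B e) (hT3 : ¬ ∃ z, Solution I B B.J₀ z)
    {g₀ : Fin m} (hg₀ : g₀ ∈ B.G₁) {u : Fin n} (hgv : (I.vars g₀ 2 = I.vars e 2 ∧ I.vars g₀ 3 = u) ∨ (I.vars g₀ 2 = u ∧ I.vars g₀ 3 = I.vars e 2))
    {κ₀ : ZMod 2} (hcoef : ∀ x, coef I B.C₁ B.G₁ (I.vars e 2) x = κ₀ + x u)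
    (hP : ∀ e' ∈ B.N, e' ≠ e → ∀ a, ((sys I B).ρ e' a = 0 ∨ (sys I B).ρ e' a = (1, 0)) ∧ ((sys I B).ρ' e' a = 0 ∨ (sys I B).ρ' e' a = (1, 0)))
    {σ : Fin n} (hσu : σ ≠ u) {κ : ZMod 2} (hq : ∀ x, qDir I B (1, 0) x = x σ + κ) :
    ∃ j₁ j₂ : Fin m, j₁ ≠ j₂ ∧ B.D e = {j₁, j₂} ∧ Disjoint (andPair I j₁) (andPair I j₂) ∧ σ ∈ andPair I j₁ ∧ u ∈ andPair I j₂ := by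
  classical
  have hinf : (sys I B).Infeasible B.N := infeasible_of_not_solution I hI hT hW hL hT3
  have h10 : ((1, 0) : V2) ≠ 0 := by decide
  have hU1 : ∀ i a, ((sys I B).ρ i a = 0 ∨ (sys I B).ρ i a = (1, 0)) ∧ ((sys I B).ρ' i a = 0 ∨ (sys I B).ρ' i a = (1, 0)) := by
    intro i a
    by_cases hi : i ∈ B.N
    · by_cases hie : i = e
      · subst hie; exact gate_reads_line I hI hG a
      · exact hP i hi hie a
    · rw [(sys_ρ_of_not_mem I B hi a).1, (sys_ρ_of_not_mem I B hi a).2]; exact ⟨Or.inl rfl, Or.inl rfl⟩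
  -- the gate reads on the sheet `{x_u = κ₀ + 1}`
  have hread : ∀ x : Fin n → ZMod 2, x u + (κ₀ + 1) = 0 → (sys I B).ρ e x ≠ 0 ∨ (sys I B).ρ' e x ≠ 0 := by
    intro x hx
    left
    rw [(gate_reads I hI hG x).1, hcoef]
    have e2 : ∀ k xu : ZMod 2, xu + (k + 1) = 0 → k + xu = 1 := by decide
    rw [e2 _ _ hx]
    exact fun h => absurd (congrArg Prod.fst h) one_ne_zero
  have hgv' : ∀ v ∈ andPair I g₀, v = σ ∨ v = u ∨ v ∈ andPair I e := by
    intro v hv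
    rcases (PstarChordEndgameTools.mem_andPair_iff I g₀ v).1 hv with rfl | rfl
    · rcases hgv with ⟨h2, -⟩ | ⟨h2, -⟩
      · exact Or.inr (Or.inr ((PstarChordEndgameTools.mem_andPair_iff I e _).2 (Or.inl h2)))
      · exact Or.inr (Or.inl h2)
    · rcases hgv with ⟨-, h3⟩ | ⟨-, h3⟩
      · exact Or.inr (Or.inl h3)
      · exact Or.inr (Or.inr ((PstarChordEndgameTools.mem_andPair_iff I e _).2 (Or.inl h3)))
  exact gate_unit_of_sheet I hI hT hS hB hW hr hd₁ hd₂ hinf h10 hU1 hG.1 hσu hq (κ₀ + 1) hread (mem_union_left _ hg₀) hgv'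

/-- **CASE P with a pin: the core is a triangle, `#J₀ = 3`.** -/
theorem card_eq_three_of_pin (I : LocalMap 4 n m) (hI : I.IsPure xorAndPred) (hT : Typed I) (hS : SimpleOverlap I) {r : ℕ}
    (hB : BoundaryExpanding r I) {B : BridgeData n m} (hW : B.WF I) (hr : (B.J₀ ∪ B.G₁ ∪ B.G₂).card ≤ r)
    (hd₁ : Disjoint B.G₁ B.J₀) (hd₂ : Disjoint B.G₂ B.J₀) (hL : Lift I B) (hX : XorClosed I B.J₀) (hPe : Peelable I (B.J₀ \ B.N))
    {e : Fin m} (hG : GateHyp I B e) (hT3 : ¬ ∃ z, Solution I B B.J₀ z)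
    {g₀ : Fin m} (hg₀ : g₀ ∈ B.G₁) {u : Fin n} (hgv : (I.vars g₀ 2 = I.vars e 2 ∧ I.vars g₀ 3 = u) ∨ (I.vars g₀ 2 = u ∧ I.vars g₀ 3 = I.vars e 2))
    {κ₀ : ZMod 2} (hcoef : ∀ x, coef I B.C₁ B.G₁ (I.vars e 2) x = κ₀ + x u)
    (hP : ∀ e' ∈ B.N, e' ≠ e → ∀ a, ((sys I B).ρ e' a = 0 ∨ (sys I B).ρ e' a = (1, 0)) ∧ ((sys I B).ρ' e' a = 0 ∨ (sys I B).ρ' e' a = (1, 0)))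
    (hread : ∀ e' ∈ B.N, e' ≠ e → ∀ a, (sys I B).ρ e' a ≠ 0 ∨ (sys I B).ρ' e' a ≠ 0)
    {σ : Fin n} (hσu : σ ≠ u) {κ : ZMod 2} (hq : ∀ x, qDir I B (1, 0) x = x σ + κ) : B.J₀.card = 3 := by
  classical
  have hJr : B.J₀.card ≤ r := (card_le_card (subset_union_left.trans subset_union_left)).trans hr
  -- one chord
  have hN : B.N = {e} := by
    refine eq_singleton_iff_unique_mem.2 ⟨hG.1, fun e' he' => ?_⟩
    exact no_other_chord_of_pin I hI hT hS hB hW hJr hL hG hT3 hP hread hq e' he'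
  -- its fundamental set is a pair
  obtain ⟨j₁, j₂, hne, hD, -, -, -⟩ := pair_of_pin I hI hT hS hB hW hr hd₁ hd₂ hL hG hT3 hg₀ hgv hcoef hP hσu hq
  -- the core is the triangle
  have hJ := J₀_eq_of_single I hI hT hW hX hPe hN
  have heD : e ∉ B.D e := fun h => (mem_sdiff.1 (hW.hD e hG.1 h)).2 hG.1
  rw [hJ, card_insert_of_notMem heD, hD, card_pair hne]

end Summit.PneNP.PneNP.Theorems.PstarGateCasePPin
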